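import Summits.QuantumFields.YangMills.Theorems.TransportPerturbationSynchronousShadowLawTransfer
import Summits.QuantumFields.YangMills.Theorems.TransportPerturbationShadowAveraging
import HarnessLib

/-!
# Route `TransportPerturbation`, LINE 16 «synchronous_shadow» (crux K2 `WeightedAlmostInvariance`, stmt-QuantumFields-26987;
# load-bearing item `RegularWindowShadow`, stmt-QuantumFields-27784): the REGISTERED STUB W `stub_couplingToWeighted` BY NAME AND SIGNATURE

The skeleton's vocabulary and the registered aliases `__Registered.*` live in the tree
(`Theorems.TransportPerturbationSynchronousShadowLawTransfer`, verbatim from planner ym-idea-5 g11's `SynchronousShadow.lean`,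
together with stub L `stub_lawTransfer`); this file proves the registered stub

  `theorem stub_couplingToWeighted : __Registered.stub_couplingToWeighted`

— FROM A COUPLING TO THE WEIGHTED DUAL BOUND (pure measure theory): on a probability space, random step-`K` configurations
`X, Y` with `E wd_K(X,Y) ≤ r²`, a bounded measurable weight `Λ ≥ 0` and a test function `g` of the weighted Lipschitz class
`𝒢_K^Λ(A)` (`|g| ≤ 1`, `|g u − g v| ≤ A·√(wd_K(u,v)(1 + Λu + Λv))`) satisfy `|E g(X) − E g(Y)| ≤ A·r·√(1 + EΛ(X) + EΛ(Y))`: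
triangle inequality for the Bochner integral, the class inequality pointwise, and Cauchy–Schwarz in the form
`∫ √(f·h) ≤ √(∫ f)·√(∫ h)` (Hölder `p = q = 2`, `integral_sqrt_mul_le`); the corner `A < 0` is vacuous because the route's
transport weight separates a pair (`Theorems.TransportPerturbation.exists_wd_pos`), and `0 ≤ wd_K ≤ 4` is the landed route item
`DiscrepancyBounds` (`discrepancyBounds_proof`).

Cell `ym-idea-1` extra width seat `ym-line-sfw-p2-w5` gen 9 (free hands; crux 22884 had no free stub).  HONEST FRAMING: the
load-bearing stub `stub_synchronousCoupling` (XL) and the shared stub `stub_fineWindowIdentity` are NOT proved here; no crux,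
route item, rung or summit is proved, and the Yang–Mills mass gap is NOT proved by any of this (R3 is a RECORD rung).
-/

set_option autoImplicit false

noncomputable section

namespace Summit.QuantumFields.YangMills.Cruxes.WeightedAlmostInvariance.SynchronousShadow

open scoped BigOperators Topology Classical MeasureTheory ProbabilityTheory NNReal ENNReal
open Filter Set Function MeasureTheory
open Literature.MathematicalPhysics.QuantumFieldTheory
open Literature.MathematicalPhysics.QuantumFieldTheory.Balaban1983to89
open Literature.MathematicalPhysics.QuantumLattice

/-! ## The registered stub W, by name and signature -/

/-- **Cauchy–Schwarz for the weighted semimetric, integrated.**  On a probability space, for real functions `f, h` with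
`0 ≤ f ≤ 4`-type bounds irrelevant — precisely: `f` measurable with `0 ≤ f ≤ C`, `h` measurable with `0 ≤ h ≤ D` —
`∫ √(f·h) ≤ √(∫ f) · √(∫ h)` (Hölder with `p = q = 2` applied to `√f`, `√h`). [folklore] -/
theorem integral_sqrt_mul_le {Ω : Type} [MeasurableSpace Ω] (P : Measure Ω) [IsProbabilityMeasure P]
    {f h : Ω → ℝ} (hfm : Measurable f) (hhm : Measurable h) {C D : ℝ}
    (hf0 : ∀ ω, 0 ≤ f ω) (hfC : ∀ ω, f ω ≤ C) (hh0 : ∀ ω, 0 ≤ h ω) (hhD : ∀ ω, h ω ≤ D) :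
    ∫ ω, Real.sqrt (f ω * h ω) ∂P ≤ Real.sqrt (∫ ω, f ω ∂P) * Real.sqrt (∫ ω, h ω ∂P) := by
  have hF0 : 0 ≤ᵐ[P] fun ω => Real.sqrt (f ω) := Eventually.of_forall fun ω => Real.sqrt_nonneg _
  have hG0 : 0 ≤ᵐ[P] fun ω => Real.sqrt (h ω) := Eventually.of_forall fun ω => Real.sqrt_nonneg _
  have hF2 : MemLp (fun ω => Real.sqrt (f ω)) (ENNReal.ofReal 2) P :=
    memLp_of_bounded (a := 0) (b := Real.sqrt C)
      (Eventually.of_forall fun ω => ⟨Real.sqrt_nonneg _, Real.sqrt_le_sqrt (hfC ω)⟩)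
      hfm.sqrt.aestronglyMeasurable _
  have hG2 : MemLp (fun ω => Real.sqrt (h ω)) (ENNReal.ofReal 2) P :=
    memLp_of_bounded (a := 0) (b := Real.sqrt D)
      (Eventually.of_forall fun ω => ⟨Real.sqrt_nonneg _, Real.sqrt_le_sqrt (hhD ω)⟩)
      hhm.sqrt.aestronglyMeasurable _
  have hCS := integral_mul_le_Lp_mul_Lq_of_nonneg Real.HolderConjugate.two_two hF0 hG0 hF2 hG2
  have e0 : ∫ ω, Real.sqrt (f ω * h ω) ∂P = ∫ ω, Real.sqrt (f ω) * Real.sqrt (h ω) ∂P :=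
    integral_congr_ae (Eventually.of_forall fun ω => Real.sqrt_mul (hf0 ω) (h ω))
  have e1 : ∫ ω, Real.sqrt (f ω) ^ (2 : ℝ) ∂P = ∫ ω, f ω ∂P :=
    integral_congr_ae (Eventually.of_forall fun ω => by simp only [Real.rpow_two, Real.sq_sqrt (hf0 ω)])
  have e2 : ∫ ω, Real.sqrt (h ω) ^ (2 : ℝ) ∂P = ∫ ω, h ω ∂P :=
    integral_congr_ae (Eventually.of_forall fun ω => by simp only [Real.rpow_two, Real.sq_sqrt (hh0 ω)])
  rw [e0, Real.sqrt_eq_rpow, Real.sqrt_eq_rpow, ← e1, ← e2]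
  exact hCS

/-- **STUB W `stub_couplingToWeighted` HOLDS.**  FROM A COUPLING TO THE WEIGHTED DUAL BOUND: on a probability space, random
configurations `X, Y` with measurable `wd_K(X,Y)` and `E wd_K(X,Y) ≤ r²` (`r ≥ 0`), a bounded measurable weight `Λ ≥ 0` and
`g ∈ 𝒢_K^Λ(A)` give `|E g(X) − E g(Y)| ≤ A·r·√(1 + EΛ(X) + EΛ(Y))`: `|E(g∘X − g∘Y)| ≤ E|g∘X − g∘Y| ≤ A·E√(wd_K(X,Y)·(1+Λ∘X+Λ∘Y))`
and Cauchy–Schwarz (`integral_sqrt_mul_le`); the corner `A < 0` is vacuous because `wd_K` separates the trivial configuration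
from its centre twist (`Theorems.TransportPerturbation.exists_wd_pos`), so `𝒢_K^Λ(A) = ∅`.  Boundedness `0 ≤ wd_K ≤ 4` is the
landed route item `DiscrepancyBounds` (`discrepancyBounds_proof`). [cite: HairerMattinglyScheutzow2011, §4] -/
theorem stub_couplingToWeighted : __Registered.stub_couplingToWeighted := by
  intro F K Ω mΩ P hP X Y hX hY hwd r hr hint Λ hΛm hΛ0 hΛb A g hg
  obtain ⟨hgm, hg1, hlip⟩ := hg
  obtain ⟨M, hM⟩ := hΛb
  have hwd0 : ∀ ω, 0 ≤ wdisc F K (X ω) (Y ω) := fun ω =>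
    (Summit.QuantumFields.YangMills.Theorems.TransportPerturbation.discrepancyBounds_proof F K (X ω) (Y ω)).1
  have hwd4 : ∀ ω, wdisc F K (X ω) (Y ω) ≤ 4 := fun ω =>
    (Summit.QuantumFields.YangMills.Theorems.TransportPerturbation.discrepancyBounds_proof F K (X ω) (Y ω)).2
  by_cases hA : A < 0
  · -- the vacuous corner: `𝒢_K^Λ(A)` is empty since `wd_K` separates a pair
    exfalso
    obtain ⟨u, v, huv⟩ := Summit.QuantumFields.YangMills.Theorems.TransportPerturbation.exists_wd_pos F K
    have hpos : 0 < dW F K Λ u v := by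
      have h1 : 0 < 1 + Λ u + Λ v := by linarith [hΛ0 u, hΛ0 v]
      exact Real.sqrt_pos.2 (mul_pos huv h1)
    have hneg : A * dW F K Λ u v < 0 := mul_neg_of_neg_of_pos hA hpos
    linarith [abs_nonneg (g u - g v), hlip u v]
  replace hA : 0 ≤ A := not_lt.mp hA
  -- the weight `h = 1 + Λ∘X + Λ∘Y`
  have hhm : Measurable fun ω => 1 + Λ (X ω) + Λ (Y ω) := (measurable_const.add (hΛm.comp hX)).add (hΛm.comp hY)
  have hh0 : ∀ ω, 0 ≤ 1 + Λ (X ω) + Λ (Y ω) := fun ω => by linarith [hΛ0 (X ω), hΛ0 (Y ω)]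
  have hhM : ∀ ω, 1 + Λ (X ω) + Λ (Y ω) ≤ 1 + M + M := fun ω => by linarith [hM (X ω), hM (Y ω)]
  -- integrability of the bounded integrands
  have hgX : Integrable (fun ω => g (X ω)) P :=
    Integrable.of_bound (hgm.comp hX).aestronglyMeasurable 1 (Eventually.of_forall fun ω => by
      simpa only [Real.norm_eq_abs] using hg1 (X ω))
  have hgY : Integrable (fun ω => g (Y ω)) P :=
    Integrable.of_bound (hgm.comp hY).aestronglyMeasurable 1 (Eventually.of_forall fun ω => by
      simpa only [Real.norm_eq_abs] using hg1 (Y ω))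
  have hΛX : Integrable (fun ω => Λ (X ω)) P :=
    Integrable.of_mem_Icc 0 M (hΛm.comp hX).aemeasurable (Eventually.of_forall fun ω => ⟨hΛ0 _, hM _⟩)
  have hΛY : Integrable (fun ω => Λ (Y ω)) P :=
    Integrable.of_mem_Icc 0 M (hΛm.comp hY).aemeasurable (Eventually.of_forall fun ω => ⟨hΛ0 _, hM _⟩)
  have hS : Integrable (fun ω => Real.sqrt (wdisc F K (X ω) (Y ω) * (1 + Λ (X ω) + Λ (Y ω)))) P :=
    Integrable.of_mem_Icc 0 (Real.sqrt (4 * (1 + M + M))) (hwd.mul hhm).sqrt.aemeasurable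
      (Eventually.of_forall fun ω => ⟨Real.sqrt_nonneg _,
        Real.sqrt_le_sqrt (mul_le_mul (hwd4 ω) (hhM ω) (hh0 ω) (by norm_num))⟩)
  -- the weight integral
  have hH : ∫ ω, (1 + Λ (X ω) + Λ (Y ω)) ∂P = 1 + (∫ ω, Λ (X ω) ∂P) + ∫ ω, Λ (Y ω) ∂P := by
    have e1 : ∫ ω, (1 + Λ (X ω) + Λ (Y ω)) ∂P = (∫ ω, (1 + Λ (X ω)) ∂P) + ∫ ω, Λ (Y ω) ∂P :=
      integral_add ((integrable_const 1).add hΛX) hΛY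
    have e2 : ∫ ω, (1 + Λ (X ω)) ∂P = (∫ _ω, (1 : ℝ) ∂P) + ∫ ω, Λ (X ω) ∂P :=
      integral_add (integrable_const 1) hΛX
    rw [e1, e2]
    simp
  -- Step 1: `|E gX − E gY| ≤ A · E √(wd·h)`
  have h1 : |(∫ ω, g (X ω) ∂P) - ∫ ω, g (Y ω) ∂P|
      ≤ A * ∫ ω, Real.sqrt (wdisc F K (X ω) (Y ω) * (1 + Λ (X ω) + Λ (Y ω))) ∂P := by
    rw [← integral_sub hgX hgY, ← integral_const_mul]
    calc |∫ ω, (g (X ω) - g (Y ω)) ∂P| ≤ ∫ ω, |g (X ω) - g (Y ω)| ∂P := abs_integral_le_integral_abs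
      _ ≤ ∫ ω, A * Real.sqrt (wdisc F K (X ω) (Y ω) * (1 + Λ (X ω) + Λ (Y ω))) ∂P :=
          integral_mono_of_nonneg (Eventually.of_forall fun ω => abs_nonneg _) (hS.const_mul A)
            (Eventually.of_forall fun ω => hlip (X ω) (Y ω))
  -- Step 2: Cauchy–Schwarz `E √(wd·h) ≤ √(E wd) · √(E h) ≤ r · √H`
  have h2 : ∫ ω, Real.sqrt (wdisc F K (X ω) (Y ω) * (1 + Λ (X ω) + Λ (Y ω))) ∂P
      ≤ r * Real.sqrt (1 + (∫ ω, Λ (X ω) ∂P) + ∫ ω, Λ (Y ω) ∂P) := by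
    have hcs := integral_sqrt_mul_le P hwd hhm hwd0 hwd4 hh0 hhM
    rw [hH] at hcs
    refine hcs.trans (mul_le_mul_of_nonneg_right ?_ (Real.sqrt_nonneg _))
    calc Real.sqrt (∫ ω, wdisc F K (X ω) (Y ω) ∂P) ≤ Real.sqrt (r ^ 2) := Real.sqrt_le_sqrt hint
      _ = r := Real.sqrt_sq hr
  exact h1.trans (mul_le_mul_of_nonneg_left h2 hA)

end Summit.QuantumFields.YangMills.Cruxes.WeightedAlmostInvariance.SynchronousShadow

end
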